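import Mathlib
import Summits.Ventures.HodgeRepro.Tier4.Common.AdelicDefs
import Summits.Ventures.HodgeRepro.Tier4.Common.AdelicRTF
import Summits.Ventures.HodgeRepro.Tier4.Line1.PlaneDefs
import Summits.Ventures.HodgeRepro.Tier4.Line1.TorusPlaneData
import Summits.Ventures.HodgeRepro.Tier4.Line1.TorusCocompact
import Summits.Ventures.HodgeRepro.Tier4.Line1.CornerCharacters

/-!
# Tier4/Line1/TorusDataPair — LINE L1, (I0-R) packaging: the torus data of the two projector pairs of a genuine
definite plane exist, and the RTF datum of four `U(1)`-characters without torus data in the binders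

Blind re-derivation cell `pub-hodge-repro`, Tier 4 «prove the step» (README §9–§10), seat t4-L1-p2 (gen 3), LINE L1,
cut (I0-R) «the character objects» (t4-plan-1 g2, S13462 (6)), packaging for the skeleton's consumer (v0.36).  Target
tree path `lean/Summits/Ventures/HodgeRepro/Tier4/Line1/TorusDataPair.lean`.  Imports t4-L1-p5's `TorusPlaneData`
(`planeTorusData`, `exists_row_ne_zero`, `projPair_P`, `projPair_Q`) and this seat's `CornerCharacters`
(`IsU1Char`, `prodChar`, `exists_rtfData_of_u1Characters`).

WHAT IS PROVED (Mathlib + the named modules only, no printed input).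
* `exists_torusData_pair (hW hg) (hΩ : Ω² = −d) (hd : ¬ IsSquare (−d))`: torus data `D` (for the `P`-pair) and `D′`
  (for the `Q`-pair) of the plane exist, with `D.B = D′.B = B`, `D.Om = D′.Om = Ωᵀ`, `D.P = (P 0)ᵀ`, `D′.P = (Q 0)ᵀ`,
  `D.d = D′.d = d` — p5's `planeTorusData` on a non-zero row of each projector.
* `exists_rtfData_of_u1Characters'`: the RTF datum of four `U(1)`-characters with N2, with NO torus data in the
  binders: for `d` the discriminant of the plane and `ν₀ … ν₃ : IsU1Char d`, there are torus data `D, D′` as above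
  and an `RTFData W` with `χ = prodChar D ν₀ ν₁ W.P`, `χ′ = prodChar D′ ν₂ ν₃ W.Q`, continuous and unitary, Haar
  torus measures and relatively compact torus domains — the `Inputs` block `R, hc, hu, hc', hu'` of the skeleton
  (v0.34 ff.) from the displayed characters alone.

Nothing here says anything about the status of the Hodge conjecture for CM abelian varieties, which is NOT proved
(HC_CM is NOT proved by anyone in this repository).
-/

set_option autoImplicit false

noncomputable section

namespace Summit.Ventures.HodgeRepro.Tier4.Line1

open NumberField MeasureTheory Summit.Ventures.HodgeRepro.Tier4.Common Matrix Rot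

variable {k : Type} [Field k] [NumberField k] {W : PlaneData k}

omit [NumberField k] in
/-- **the torus data of a projector pair of a genuine definite plane exist**, with the fields the line's lemmas
consume (`hDB hDOm hDP hDd`): p5's `planeTorusData` on non-zero rows `v`, `w` fixed by `P 0`, `P 1`. -/
theorem exists_torusData_of_projPair (hW : IsDefinite W) (hg : IsGenuineRow W) {d : k}
    (hΩ : W.Ω * W.Ω = -(d • (1 : Matrix (Fin 4) (Fin 4) k))) (hd : ¬ IsSquare (-d))
    {P : Fin 2 → Matrix (Fin 4) (Fin 4) k} (hP : ProjPair W P) :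
    ∃ D : TorusData k, D.B = W.B ∧ D.Om = W.Ωᵀ ∧ D.P = (P 0)ᵀ ∧ D.d = d := by
  obtain ⟨v, hv, hv0⟩ := exists_row_ne_zero (hP.rank 0) (hP.idem 0)
  obtain ⟨w, hw, hw1⟩ := exists_row_ne_zero (hP.rank 1) (hP.idem 1)
  exact ⟨planeTorusData W hW hΩ hd hg.2.1 hP hv hw hv0 hw1, rfl, rfl, rfl, rfl⟩

omit [NumberField k] in
/-- **the torus data of the two tori `T` (the `P`-pair) and `T′` (the `Q`-pair) of a genuine definite plane exist**,
with the common discriminant `d` (`Ω² = −d`). -/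
theorem exists_torusData_pair (hW : IsDefinite W) (hg : IsGenuineRow W) {d : k}
    (hΩ : W.Ω * W.Ω = -(d • (1 : Matrix (Fin 4) (Fin 4) k))) (hd : ¬ IsSquare (-d)) :
    ∃ D D' : TorusData k, D.B = W.B ∧ D.Om = W.Ωᵀ ∧ D.P = (W.P 0)ᵀ ∧ D.d = d ∧
      D'.B = W.B ∧ D'.Om = W.Ωᵀ ∧ D'.P = (W.Q 0)ᵀ ∧ D'.d = d := by
  obtain ⟨D, hDB, hDOm, hDP, hDd⟩ := exists_torusData_of_projPair hW hg hΩ hd (projPair_P W hg)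
  obtain ⟨D', hD'B, hD'Om, hD'P, hD'd⟩ := exists_torusData_of_projPair hW hg hΩ hd (projPair_Q W hg)
  exact ⟨D, D', hDB, hDOm, hDP, hDd, hD'B, hD'Om, hD'P, hD'd⟩

/-- **the RTF datum of four `U(1)`-characters and N2, with no torus data in the binders**: torus data `D, D′` of the
plane and an `RTFData W` with the characters `ν₀ ⊗ ν₁`, `ν₂ ⊗ ν₃` (continuous, unitary), Haar torus measures and
relatively compact torus domains exist — the `Inputs` block `R, hc, hu, hc', hu'` of the skeleton from the displayed
characters `ν₀ … ν₃ : IsU1Char d` and the displayed equation `ν₀ ν₁ = ν₂ ν₃` on `E′¹(𝔸)`. -/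
theorem exists_rtfData_of_u1Characters' [MeasurableSpace (GA W)] [BorelSpace (GA W)] (hW : IsDefinite W)
    (hg : IsGenuineRow W) {d : k} (hΩ : W.Ω * W.Ω = -(d • (1 : Matrix (Fin 4) (Fin 4) k)))
    (hd : ¬ IsSquare (-d)) (ν₀ ν₁ ν₂ ν₃ : (Fin 2 → Ad k) → ℂ) (h₀ : IsU1Char d ν₀) (h₁ : IsU1Char d ν₁)
    (h₂ : IsU1Char d ν₂) (h₃ : IsU1Char d ν₃)
    (hN2 : ∀ s : Fin 2 → Ad k, qnorm (algebraMap k (Ad k) d) s = 1 → ν₀ s * ν₁ s = ν₂ s * ν₃ s) :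
    ∃ D D' : TorusData k, D.B = W.B ∧ D.Om = W.Ωᵀ ∧ D.P = (W.P 0)ᵀ ∧ D.d = d ∧
      D'.B = W.B ∧ D'.Om = W.Ωᵀ ∧ D'.P = (W.Q 0)ᵀ ∧ D'.d = d ∧
      ∃ R : RTFData W, R.chi = prodChar D ν₀ ν₁ W.P ∧ R.chi' = prodChar D' ν₂ ν₃ W.Q ∧
        Continuous R.chi ∧ (∀ a, ‖R.chi a‖ = 1) ∧ Continuous R.chi' ∧ (∀ a, ‖R.chi' a‖ = 1) ∧
        R.μT.IsHaarMeasure ∧ R.μT'.IsHaarMeasure ∧ IsCompact (closure R.DT) ∧ IsCompact (closure R.DT') := by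
  obtain ⟨D, D', hDB, hDOm, hDP, hDd, hD'B, hD'Om, hD'P, hD'd⟩ := exists_torusData_pair hW hg hΩ hd
  exact ⟨D, D', hDB, hDOm, hDP, hDd, hD'B, hD'Om, hD'P, hD'd,
    exists_rtfData_of_u1Characters hW hg D D' hDB hDOm hDP hD'B hD'Om hD'P hDd hD'd ν₀ ν₁ ν₂ ν₃ h₀ h₁ h₂ h₃ hN2⟩

end Summit.Ventures.HodgeRepro.Tier4.Line1

end
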